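import Summits.CriticalPhenomena.PercolationContinuityZ3.Theorems.Transplant.FKConnectivityAllQAntipodalOrAttSeries
import Summits.CriticalPhenomena.PercolationContinuityZ3.Theorems.Transplant.FKConnectivityAllQAntipodalOrAttSeriesSame
import Summits.CriticalPhenomena.PercolationContinuityZ3.Theorems.Transplant.FKConnectivityAllQAntipodalOrAttParallel
import Summits.CriticalPhenomena.PercolationContinuityZ3.Theorems.Transplant.FKConnectivityAllQAntipodalOrAttInputs
import HarnessLib

/-!
# Connectivity correlation inequalities for `φ_{w,q}`, every `q > 0` — file 47e: THE OR-ATTACHED DRIFT THEOREM — `O(N; y, z; C) ≤ 0` on every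
# two-terminal series–parallel network, every cell, every ANTITONE level weight (the `q`-free level-3 inequality for the type `x ∧ (y ∨ z)`)

Support file (`--supports stmt-CriticalPhenomena-4575`), FK sub-lane `prim-bschramm-fk-2` (gen 22); builds on p205010 (kernel theorem,
internal audit signed; external expert review pending).  No definitions, no named facts, no sorries; standard axioms.

**`FK.orAttW_drift_nonpos_of_isTTSP`.**  `E` TTSP between `s, t`, `st ∉ E`, `N ⊆ E` (free), `C ⊆ E` (contracted), `y ≠ z ∈ E` outside `N ∪ C`,
`N ∩ C = ∅`, `w` antitone, `h` monotone on the subsets of `N` ⟹ with `D(A | B) = ∑_{γ ⊆ N} (w(k(γ∪A∪st)+k((N\γ)∪B)) − w(k((N\γ)∪A∪st)+k(γ∪B))) h(γ)`: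
`D(yzC | C) + D(zC | yC) + D(yC | zC) ≤ 0`.
Strong induction on `|E|` shaped exactly like gen 19/21's master AND theorem (`…AndGenWeightPath`): inside the step, (R) the ROOTLESS form is a
rootless AND-contracted drift plus a cancelling pair (`FK.orAttW_rootless_nonpos` of `…OrAttInputs`, no induction); (V) the VIRTUAL-ROOT form (root possibly an edge
of the network): root outside ⇒ IH; root `= y` or `= z` ⇒ pairing lemma + rootless master pieces; root contracted ⇒ rootless form; root free ⇒
doubled-root decomposition of each drift (`FK.twoSidedW_doubled_eq`, remainders `≤ 0`) ⇒ IH on `F \ root` + rootless form; root deleted ⇒ IH on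
`F \ root`.  Then `cases` on the root junction of `E`: series/parallel × (separating `y|z` — `…OrAttSeries` / `…OrAttParallel`, all inputs from
the master theorem — or one-sided — `…OrAttSeriesSame` / `…OrAttParallel`, inputs (V), (R) and U-drifts).  The bridge to `apPsiC` (the type
`x ∧ (y ∨ z)` and its dual `x ∨ (y ∧ z)`, every cell, every level) is `…OrAttPlus`.
[cite: Grimmett2006, §1.4 eq. (1.20) (p. 15); §3.8 Thm. (3.90) (pp. 61–62); §3.9 (pp. 63–64)] [cite: Wagner2006, Thm. 5.8(d), §5.3]
-/

noncomputable section

namespace Summit.CriticalPhenomena.PercolationContinuityZ3.Theorems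

namespace FK

open SimpleGraph Literature.Probability.LatticeModels Literature.Probability.Percolation
open scoped Classical

variable {V : Type*} [Fintype V]

section OrAttPath

/-- **THE OR-ATTACHED DRIFT THEOREM FOR ANTITONE LEVEL WEIGHTS** (strong induction on the size of the network; see the module docstring).
[cite: Grimmett2006, §3.8 Thm. (3.90) (pp. 61–62); §3.9 (pp. 63–64)] [cite: Wagner2006, Thm. 5.8(d), §5.3] -/
theorem orAttW_drift_nonpos_of_isTTSP :
    ∀ (n : ℕ) {E : Finset (Sym2 V)} {s t : V} {N C : Finset (Sym2 V)} {y z : Sym2 V}, E.card ≤ n → IsTTSP E s t → s(s, t) ∉ E →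
      N ⊆ E → C ⊆ E → y ∈ E → z ∈ E → y ≠ z → y ∉ N → z ∉ N → y ∉ C → z ∉ C → Disjoint N C →
      ∀ w : ℕ → ℝ, (∀ k : ℕ, w (k + 1) ≤ w k) →
      ∀ h : Finset (Sym2 V) → ℝ, (∀ ⦃X Y : Finset (Sym2 V)⦄, X ⊆ Y → Y ⊆ N → h X ≤ h Y) →
        ∑ γ ∈ N.powerset,
          (w (clusterCount (↑(insert s(s, t) (γ ∪ insert y (insert z C))) : BondConfig V) ∅ +
                clusterCount (↑(N \ γ ∪ C) : BondConfig V) ∅) -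
            w (clusterCount (↑(insert s(s, t) (N \ γ ∪ insert y (insert z C))) : BondConfig V) ∅ +
                clusterCount (↑(γ ∪ C) : BondConfig V) ∅)) * h γ +
        ∑ γ ∈ N.powerset,
          (w (clusterCount (↑(insert s(s, t) (γ ∪ insert z C)) : BondConfig V) ∅ +
                clusterCount (↑(N \ γ ∪ insert y C) : BondConfig V) ∅) -
            w (clusterCount (↑(insert s(s, t) (N \ γ ∪ insert z C)) : BondConfig V) ∅ +
                clusterCount (↑(γ ∪ insert y C) : BondConfig V) ∅)) * h γ +
        ∑ γ ∈ N.powerset,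
          (w (clusterCount (↑(insert s(s, t) (γ ∪ insert y C)) : BondConfig V) ∅ +
                clusterCount (↑(N \ γ ∪ insert z C) : BondConfig V) ∅) -
            w (clusterCount (↑(insert s(s, t) (N \ γ ∪ insert y C)) : BondConfig V) ∅ +
                clusterCount (↑(γ ∪ insert z C) : BondConfig V) ∅)) * h γ ≤ 0 := by
  intro n
  induction n with
  | zero =>
    intro E s t N C y z hcard hE _ _ _ _ _ _ _ _ _ _ _ _ _ _ _
    rw [Nat.le_zero, Finset.card_eq_zero] at hcard
    obtain ⟨e, he, _⟩ := hE.left_mem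
    rw [hcard] at he
    exact absurd he (Finset.notMem_empty _)
  | succ n ih =>
    -- (V) the drift-triple with a VIRTUAL root `uv` (possibly an edge of the network) of a network of size `≤ n`
    have virt : ∀ {F : Finset (Sym2 V)} {u v : V} {N C : Finset (Sym2 V)} {y z : Sym2 V}, F.card ≤ n → IsTTSP F u v →
        N ⊆ F → C ⊆ F → y ∈ F → z ∈ F → y ≠ z → y ∉ N → z ∉ N → y ∉ C → z ∉ C → Disjoint N C →
        ∀ w : ℕ → ℝ, (∀ k : ℕ, w (k + 1) ≤ w k) →
        ∀ h : Finset (Sym2 V) → ℝ, (∀ ⦃X Y : Finset (Sym2 V)⦄, X ⊆ Y → Y ⊆ N → h X ≤ h Y) →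
          ∑ γ ∈ N.powerset,
            (w (clusterCount (↑(insert s(u, v) (γ ∪ insert y (insert z C))) : BondConfig V) ∅ +
                  clusterCount (↑(N \ γ ∪ C) : BondConfig V) ∅) -
              w (clusterCount (↑(insert s(u, v) (N \ γ ∪ insert y (insert z C))) : BondConfig V) ∅ +
                  clusterCount (↑(γ ∪ C) : BondConfig V) ∅)) * h γ +
          ∑ γ ∈ N.powerset,
            (w (clusterCount (↑(insert s(u, v) (γ ∪ insert z C)) : BondConfig V) ∅ +
                  clusterCount (↑(N \ γ ∪ insert y C) : BondConfig V) ∅) -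
              w (clusterCount (↑(insert s(u, v) (N \ γ ∪ insert z C)) : BondConfig V) ∅ +
                  clusterCount (↑(γ ∪ insert y C) : BondConfig V) ∅)) * h γ +
          ∑ γ ∈ N.powerset,
            (w (clusterCount (↑(insert s(u, v) (γ ∪ insert y C)) : BondConfig V) ∅ +
                  clusterCount (↑(N \ γ ∪ insert z C) : BondConfig V) ∅) -
              w (clusterCount (↑(insert s(u, v) (N \ γ ∪ insert y C)) : BondConfig V) ∅ +
                  clusterCount (↑(γ ∪ insert z C) : BondConfig V) ∅)) * h γ ≤ 0 := by
      intro F u v N C y z hF hFT hN hC hy hz hyz hyN hzN hyC hzC hNC w hw h hm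
      by_cases huvF : s(u, v) ∈ F
      swap
      · exact ih hF hFT huvF hN hC hy hz hyz hyN hzN hyC hzC hNC w hw h hm
      have hCF : C ⊆ insert s(u, v) F := hC.trans (Finset.subset_insert _ _)
      by_cases huvy : s(u, v) = y
      · -- root = y: (yzC|C) + (yC|zC) pair into the rootless drift of `N ∪ {z}` with `(yC | C)`; (zC|yC) becomes rootless `(yzC | yC)`
        subst huvy
        have e1 : ∀ X : Finset (Sym2 V), insert s(u, v) (X ∪ insert s(u, v) (insert z C)) = X ∪ insert z (insert s(u, v) C) := fun X => by
          simp only [Finset.union_insert, Finset.insert_idem]; exact Finset.insert_comm _ _ _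
        have e2 : ∀ X : Finset (Sym2 V), insert s(u, v) (X ∪ insert z C) = X ∪ insert s(u, v) (insert z C) := fun X =>
          (Finset.union_insert _ _ _).symm
        have e3 : ∀ X : Finset (Sym2 V), insert s(u, v) (X ∪ insert s(u, v) C) = X ∪ insert s(u, v) C := fun X => by
          simp only [Finset.union_insert, Finset.insert_idem]
        simp_rw [e1, e2, e3]
        have pair := twoSidedW_pair_insert_rootless_eq w (insert s(u, v) C) C hzN h
        have i₁ := andGenW_rootless_nonpos_of_isTTSP hFT (N := insert z N) (A := insert s(u, v) C) (C := C)
          (Finset.insert_subset hz hN) (Finset.insert_subset_insert _ hC) (Finset.subset_insert _ _)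
          (Finset.disjoint_insert_left.2 ⟨by
            rw [Finset.mem_insert, not_or]; exact ⟨fun hh => hyz hh.symm, hzC⟩,
            Finset.disjoint_insert_right.2 ⟨hyN, hNC⟩⟩) hw
          (h := fun γ => h (γ.erase z)) (fun X Y hXY hY => hm (Finset.erase_subset_erase _ hXY) (by
            intro e he
            have he' := hY (Finset.mem_of_mem_erase he)
            rcases Finset.mem_insert.1 he' with h' | h'
            · exact absurd h' (Finset.ne_of_mem_erase he)
            · exact h'))
        have i₂ := andGenW_rootless_nonpos_of_isTTSP hFT hN (A := insert s(u, v) (insert z C)) (C := insert s(u, v) C)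
          (Finset.insert_subset (Finset.mem_insert_self _ _) (Finset.insert_subset (Finset.mem_insert_of_mem hz) hCF))
          (Finset.insert_subset_insert _ (Finset.subset_insert _ _))
          (Finset.disjoint_insert_right.2 ⟨hyN, Finset.disjoint_insert_right.2 ⟨hzN, hNC⟩⟩) hw hm
        rw [pair.symm] at i₁
        linarith
      by_cases huvz : s(u, v) = z
      · -- root = z: (yzC|C) + (zC|yC) pair into the rootless drift of `N ∪ {y}` with `(zC | C)`; (yC|zC) becomes rootless `(yzC | zC)`
        subst huvz
        have e1 : ∀ X : Finset (Sym2 V), insert s(u, v) (X ∪ insert y (insert s(u, v) C)) = X ∪ insert y (insert s(u, v) C) := fun X => by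
          simp only [Finset.union_insert]; rw [Finset.insert_comm (s(u, v)) y, Finset.insert_idem]
        have e2 : ∀ X : Finset (Sym2 V), insert s(u, v) (X ∪ insert s(u, v) C) = X ∪ insert s(u, v) C := fun X => by
          simp only [Finset.union_insert, Finset.insert_idem]
        have e3 : ∀ X : Finset (Sym2 V), insert s(u, v) (X ∪ insert y C) = X ∪ insert y (insert s(u, v) C) := fun X => by
          simp only [Finset.union_insert]; exact Finset.insert_comm _ _ _
        simp_rw [e1, e2, e3]
        have pair := twoSidedW_pair_insert_rootless_eq w (insert s(u, v) C) C hyN h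
        have i₁ := andGenW_rootless_nonpos_of_isTTSP hFT (N := insert y N) (A := insert s(u, v) C) (C := C)
          (Finset.insert_subset hy hN) (Finset.insert_subset_insert _ hC) (Finset.subset_insert _ _)
          (Finset.disjoint_insert_left.2 ⟨by
            rw [Finset.mem_insert, not_or]; exact ⟨hyz, hyC⟩,
            Finset.disjoint_insert_right.2 ⟨hzN, hNC⟩⟩) hw
          (h := fun γ => h (γ.erase y)) (fun X Y hXY hY => hm (Finset.erase_subset_erase _ hXY) (by
            intro e he
            have he' := hY (Finset.mem_of_mem_erase he)
            rcases Finset.mem_insert.1 he' with h' | h'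
            · exact absurd h' (Finset.ne_of_mem_erase he)
            · exact h'))
        have i₂ := andGenW_rootless_nonpos_of_isTTSP hFT hN (A := insert y (insert s(u, v) C)) (C := insert s(u, v) C)
          (Finset.insert_subset (Finset.mem_insert_of_mem hy) (Finset.insert_subset (Finset.mem_insert_self _ _) hCF))
          (Finset.subset_insert _ _)
          (Finset.disjoint_insert_right.2 ⟨hyN, Finset.disjoint_insert_right.2 ⟨hzN, hNC⟩⟩) hw hm
        rw [pair.symm] at i₁
        linarith
      by_cases huvC : s(u, v) ∈ C
      · -- root contracted: everything is rootless
        have hins : ∀ X Y : Finset (Sym2 V), C ⊆ Y → insert s(u, v) (X ∪ Y) = X ∪ Y := fun X Y hY =>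
          Finset.insert_eq_of_mem (Finset.mem_union_right _ (hY huvC))
        have sC : C ⊆ insert y (insert z C) := (Finset.subset_insert _ _).trans (Finset.subset_insert _ _)
        simp_rw [hins _ _ sC, hins _ _ (Finset.subset_insert z C), hins _ _ (Finset.subset_insert y C)]
        exact orAttW_rootless_nonpos hFT hN hCF (Finset.mem_insert_of_mem hy) (Finset.mem_insert_of_mem hz) hyN hzN hNC hw hm
      have hF1 : F ≠ {s(u, v)} := fun hh => huvy (by
        have := hy; rw [hh, Finset.mem_singleton] at this; exact this.symm)
      have hE' : IsTTSP (F.erase s(u, v)) u v := hFT.erase_terminal_edge huvF hF1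
      have hcard' : (F.erase s(u, v)).card ≤ n := (Finset.card_erase_le).trans hF
      have hyF' : y ∈ F.erase s(u, v) := Finset.mem_erase.2 ⟨fun hh => huvy hh.symm, hy⟩
      have hzF' : z ∈ F.erase s(u, v) := Finset.mem_erase.2 ⟨fun hh => huvz hh.symm, hz⟩
      have hCF' : C ⊆ F.erase s(u, v) := fun f hf => Finset.mem_erase.2 ⟨fun hh => huvC (hh ▸ hf), hC hf⟩
      by_cases huvN : s(u, v) ∈ N
      · -- root free: the doubled root, drift by drift
        rw [twoSidedW_doubled_eq w (insert y (insert z C)) C huvN h, twoSidedW_doubled_eq w (insert z C) (insert y C) huvN h,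
          twoSidedW_doubled_eq w (insert y C) (insert z C) huvN h]
        have r₁ := twoSidedW_doubled_rem_nonpos hw (insert y (insert z C)) C huvN hm
        have r₂ := twoSidedW_doubled_rem_nonpos hw (insert z C) (insert y C) huvN hm
        have r₃ := twoSidedW_doubled_rem_nonpos hw (insert y C) (insert z C) huvN hm
        have hN'N : N.erase s(u, v) ⊆ N := Finset.erase_subset _ _
        -- the recursive part: IH on `F \ uv` against `h(· ∪ uv)`
        have hrec := ih hcard' hE' (Finset.notMem_erase _ _) (Finset.erase_subset_erase _ hN) hCF' hyF' hzF' hyz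
          (fun hh => hyN (hN'N hh)) (fun hh => hzN (hN'N hh)) hyC hzC (Finset.disjoint_of_subset_left hN'N hNC) w hw
          (fun γ => h (insert s(u, v) γ)) (fun X Y hXY hY =>
            hm (Finset.insert_subset_insert _ hXY) (Finset.insert_subset huvN (hY.trans hN'N)))
        -- the contracted part: rootless, `uv` inserted on both sides
        have con := orAttW_rootless_nonpos hFT (hN'N.trans hN) (C := insert s(u, v) C) (Finset.insert_subset_insert _ hC)
          (Finset.mem_insert_of_mem hy) (Finset.mem_insert_of_mem hz) (fun hh => hyN (hN'N hh)) (fun hh => hzN (hN'N hh))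
          (Finset.disjoint_insert_right.2 ⟨Finset.notMem_erase _ _, Finset.disjoint_of_subset_left hN'N hNC⟩) hw
          (h := h) (fun X Y hXY hY => hm hXY (hY.trans hN'N))
        have e1 : ∀ X : Finset (Sym2 V), X ∪ insert y (insert z (insert s(u, v) C)) = insert s(u, v) (X ∪ insert y (insert z C)) :=
          fun X => by simp only [Finset.union_insert]; rw [Finset.insert_comm (s(u, v)) y, Finset.insert_comm (s(u, v)) z]
        have e2 : ∀ X : Finset (Sym2 V), X ∪ insert z (insert s(u, v) C) = insert s(u, v) (X ∪ insert z C) := fun X => by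
          simp only [Finset.union_insert]; exact Finset.insert_comm _ _ _
        have e3 : ∀ X : Finset (Sym2 V), X ∪ insert y (insert s(u, v) C) = insert s(u, v) (X ∪ insert y C) := fun X => by
          simp only [Finset.union_insert]; exact Finset.insert_comm _ _ _
        have e4 : ∀ X : Finset (Sym2 V), X ∪ insert s(u, v) C = insert s(u, v) (X ∪ C) := fun X => Finset.union_insert _ _ _
        simp_rw [e1, e2, e3, e4] at con
        linarith
      · -- root deleted: IH on `F \ uv`
        exact ih hcard' hE' (Finset.notMem_erase _ _) (fun f hf => Finset.mem_erase.2 ⟨fun hh => huvN (hh ▸ hf), hN hf⟩) hCF'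
          hyF' hzF' hyz hyN hzN hyC hzC hNC w hw h hm
    -- the step: decompose `E` at its root
    intro E s t N C y z hcard hE hst hN hC hy hz hyz hyN hzN hyC hzC hNC w hw h hmono
    have hyN₁ : ∀ F : Finset (Sym2 V), y ∉ N ∩ F := fun F hh => hyN (Finset.mem_of_mem_inter_left hh)
    have hzN₁ : ∀ F : Finset (Sym2 V), z ∉ N ∩ F := fun F hh => hzN (Finset.mem_of_mem_inter_left hh)
    have hyC₁ : ∀ F : Finset (Sym2 V), y ∉ C ∩ F := fun F hh => hyC (Finset.mem_of_mem_inter_left hh)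
    have hzC₁ : ∀ F : Finset (Sym2 V), z ∉ C ∩ F := fun F hh => hzC (Finset.mem_of_mem_inter_left hh)
    have hNCF : ∀ F : Finset (Sym2 V), Disjoint (N ∩ F) (C ∩ F) := fun F =>
      Finset.disjoint_of_subset_left Finset.inter_subset_left (Finset.disjoint_of_subset_right Finset.inter_subset_left hNC)
    have hNF : ∀ F : Finset (Sym2 V), N ∩ F ⊆ F := fun F => Finset.inter_subset_right
    have hCF : ∀ F : Finset (Sym2 V), C ∩ F ⊆ F := fun F => Finset.inter_subset_right
    cases hE with
    | edge hst' => exact absurd (Finset.mem_singleton_self _) hst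
    | @series E₁ E₂ _ m _ h₁ h₂ hd hV hs' ht' =>
      have hNeq : N = N ∩ E₁ ∪ N ∩ E₂ := by rw [← Finset.inter_union_distrib_left, Finset.inter_eq_left.2 hN]
      have hCeq : C = C ∩ E₁ ∪ C ∩ E₂ := by rw [← Finset.inter_union_distrib_left, Finset.inter_eq_left.2 hC]
      set V₁ : Set V := {x | ∃ e ∈ E₁, x ∈ e} with hV₁
      set V₂ : Set V := {x | ∃ e ∈ E₂, x ∈ e} with hV₂
      have g₁ : ∀ e ∈ (↑E₁ : Set (Sym2 V)), ∀ x ∈ e, x ∈ V₁ := fun e he x hx => ⟨e, he, hx⟩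
      have g₂ : ∀ e ∈ (↑E₂ : Set (Sym2 V)), ∀ x ∈ e, x ∈ V₂ := fun e he x hx => ⟨e, he, hx⟩
      have gS : V₁ ∩ V₂ ⊆ ({m} : Set V) := fun x hx => hV x hx.1 hx.2
      have hsV₂ : s ∉ V₂ := fun ⟨e, he, hse⟩ => hs' e he hse
      have htV₁ : t ∉ V₁ := fun ⟨e, he, hte⟩ => ht' e he hte
      have hsm : s ≠ m := h₁.ne
      have htm : t ≠ m := h₂.ne.symm
      have hstne : s ≠ t := by
        obtain ⟨e, he, hte⟩ := h₂.right_mem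
        intro hh; exact hs' e he (hh ▸ hte)
      have hc := Finset.card_union_of_disjoint hd
      have hcard₁ : E₁.card ≤ n := by
        obtain ⟨e, he, _⟩ := h₂.left_mem
        have h2pos : 0 < E₂.card := Finset.card_pos.2 ⟨e, he⟩
        omega
      have hcard₂ : E₂.card ≤ n := by
        obtain ⟨e, he, _⟩ := h₁.left_mem
        have h1pos : 0 < E₁.card := Finset.card_pos.2 ⟨e, he⟩
        omega
      have hdN : Disjoint (N ∩ E₁) (N ∩ E₂) :=
        Finset.disjoint_of_subset_left Finset.inter_subset_right (Finset.disjoint_of_subset_right Finset.inter_subset_right hd)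
      rw [hNeq] at hmono
      rw [hNeq, hCeq]
      rcases Finset.mem_union.1 hy with hy₁ | hy₂ <;> rcases Finset.mem_union.1 hz with hz₁ | hz₂
      · -- y, z ∈ E₁
        have e1 : insert y (insert z (C ∩ E₁ ∪ C ∩ E₂)) = insert y (insert z (C ∩ E₁)) ∪ C ∩ E₂ := by
          rw [Finset.insert_union, Finset.insert_union]
        have e2 : insert z (C ∩ E₁ ∪ C ∩ E₂) = insert z (C ∩ E₁) ∪ C ∩ E₂ := (Finset.insert_union _ _ _).symm
        have e3 : insert y (C ∩ E₁ ∪ C ∩ E₂) = insert y (C ∩ E₁) ∪ C ∩ E₂ := (Finset.insert_union _ _ _).symm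
        rw [e1, e2, e3]
        exact orAttW_series_same₁_nonpos g₁ g₂ gS hsV₂ htV₁ hsm htm hstne hdN (hNF _) (hCF _) hy₁ hz₁ (hNF _) (hCF _)
          (fun w' hw' h' hm' => virt hcard₁ h₁ (hNF _) (hCF _) hy₁ hz₁ hyz (hyN₁ _) (hzN₁ _) (hyC₁ _) (hzC₁ _) (hNCF _) w' hw' h' hm')
          (orAtt_inRR h₁ hy₁ hz₁ hyN hzN hNC) (orAtt_inP h₂ hNC) hw hmono
      · -- y ∈ E₁, z ∈ E₂: the separating junction
        have e1 : insert y (insert z (C ∩ E₁ ∪ C ∩ E₂)) = insert y (C ∩ E₁) ∪ insert z (C ∩ E₂) := by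
          rw [Finset.insert_union, Finset.union_insert]
        have e2 : insert z (C ∩ E₁ ∪ C ∩ E₂) = C ∩ E₁ ∪ insert z (C ∩ E₂) := (Finset.union_insert _ _ _).symm
        have e3 : insert y (C ∩ E₁ ∪ C ∩ E₂) = insert y (C ∩ E₁) ∪ C ∩ E₂ := (Finset.insert_union _ _ _).symm
        rw [e1, e2, e3]
        exact orAttW_series_split_nonpos g₁ g₂ gS hsV₂ htV₁ hsm htm hstne hdN (hNF _) (hCF _) hy₁ (hyN₁ _) (hNF _) (hCF _)
          hz₂ (hzN₁ _) (orAtt_inU h₁ hy₁ hyC hNC) (orAtt_inA h₁ hy₁ hyN hNC) (orAtt_inR h₁ hy₁ hyN hNC) (orAtt_inU h₂ hz₂ hzC hNC) (orAtt_inA h₂ hz₂ hzN hNC) (orAtt_inR h₂ hz₂ hzN hNC) hw hmono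
      · -- y ∈ E₂, z ∈ E₁: the separating junction with the roles of y and z exchanged
        have e1 : insert y (insert z (C ∩ E₁ ∪ C ∩ E₂)) = insert z (C ∩ E₁) ∪ insert y (C ∩ E₂) := by
          rw [Finset.insert_comm, Finset.insert_union, Finset.union_insert]
        have e2 : insert z (C ∩ E₁ ∪ C ∩ E₂) = insert z (C ∩ E₁) ∪ C ∩ E₂ := (Finset.insert_union _ _ _).symm
        have e3 : insert y (C ∩ E₁ ∪ C ∩ E₂) = C ∩ E₁ ∪ insert y (C ∩ E₂) := (Finset.union_insert _ _ _).symm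
        rw [e1, e2, e3]
        have key := orAttW_series_split_nonpos g₁ g₂ gS hsV₂ htV₁ hsm htm hstne hdN (hNF _) (hCF _) hz₁ (hzN₁ _) (hNF _) (hCF _)
          hy₂ (hyN₁ _) (orAtt_inU h₁ hz₁ hzC hNC) (orAtt_inA h₁ hz₁ hzN hNC) (orAtt_inR h₁ hz₁ hzN hNC) (orAtt_inU h₂ hy₂ hyC hNC) (orAtt_inA h₂ hy₂ hyN hNC) (orAtt_inR h₂ hy₂ hyN hNC) hw hmono
        linarith
      · -- y, z ∈ E₂
        have e1 : insert y (insert z (C ∩ E₁ ∪ C ∩ E₂)) = C ∩ E₁ ∪ insert y (insert z (C ∩ E₂)) := by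
          rw [Finset.union_insert, Finset.union_insert]
        have e2 : insert z (C ∩ E₁ ∪ C ∩ E₂) = C ∩ E₁ ∪ insert z (C ∩ E₂) := (Finset.union_insert _ _ _).symm
        have e3 : insert y (C ∩ E₁ ∪ C ∩ E₂) = C ∩ E₁ ∪ insert y (C ∩ E₂) := (Finset.union_insert _ _ _).symm
        rw [e1, e2, e3]
        exact orAttW_series_same₂_nonpos g₁ g₂ gS hsV₂ htV₁ hsm htm hstne hdN (hNF _) (hCF _) (hNF _) (hCF _) hy₂ hz₂ (orAtt_inP h₁ hNC)
          (fun w' hw' h' hm' => virt hcard₂ h₂ (hNF _) (hCF _) hy₂ hz₂ hyz (hyN₁ _) (hzN₁ _) (hyC₁ _) (hzC₁ _) (hNCF _) w' hw' h' hm')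
          (orAtt_inRR h₂ hy₂ hz₂ hyN hzN hNC) hw hmono
    | @parallel E₁ E₂ _ _ h₁ h₂ hd hV =>
      set V₁ : Set V := {x | ∃ e ∈ E₁, x ∈ e} with hV₁
      set V₂ : Set V := {x | ∃ e ∈ E₂, x ∈ e} with hV₂
      have g₁ : ∀ e ∈ (↑E₁ : Set (Sym2 V)), ∀ x ∈ e, x ∈ V₁ := fun e he x hx => ⟨e, he, hx⟩
      have g₂ : ∀ e ∈ (↑E₂ : Set (Sym2 V)), ∀ x ∈ e, x ∈ V₂ := fun e he x hx => ⟨e, he, hx⟩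
      have gS : V₁ ∩ V₂ ⊆ ({s, t} : Set V) := by
        intro x hx
        rcases hV x hx.1 hx.2 with h' | h'
        · exact Or.inl h'
        · exact Or.inr h'
      have gS' : V₂ ∩ V₁ ⊆ ({s, t} : Set V) := fun x hx => gS ⟨hx.2, hx.1⟩
      have hstne : s ≠ t := h₁.ne
      have hE₁ : E₁ ⊆ E₁ ∪ E₂ := Finset.subset_union_left
      have hE₂ : E₂ ⊆ E₁ ∪ E₂ := Finset.subset_union_right
      have hst₁ : s(s, t) ∉ E₁ := fun hh => hst (hE₁ hh)
      have hst₂ : s(s, t) ∉ E₂ := fun hh => hst (hE₂ hh)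
      have hc := Finset.card_union_of_disjoint hd
      have hcard₁ : E₁.card ≤ n := by
        obtain ⟨e, he, _⟩ := h₂.left_mem
        have h2pos : 0 < E₂.card := Finset.card_pos.2 ⟨e, he⟩
        omega
      have hcard₂ : E₂.card ≤ n := by
        obtain ⟨e, he, _⟩ := h₁.left_mem
        have h1pos : 0 < E₁.card := Finset.card_pos.2 ⟨e, he⟩
        omega
      have hdN : Disjoint (N ∩ E₁) (N ∩ E₂) :=
        Finset.disjoint_of_subset_left Finset.inter_subset_right (Finset.disjoint_of_subset_right Finset.inter_subset_right hd)
      rcases Finset.mem_union.1 hy with hy₁ | hy₂ <;> rcases Finset.mem_union.1 hz with hz₁ | hz₂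
      · -- y, z ∈ E₁
        have hNeq : N = N ∩ E₁ ∪ N ∩ E₂ := by rw [← Finset.inter_union_distrib_left, Finset.inter_eq_left.2 hN]
        have hCeq : C = C ∩ E₁ ∪ C ∩ E₂ := by rw [← Finset.inter_union_distrib_left, Finset.inter_eq_left.2 hC]
        rw [hNeq] at hmono
        rw [hNeq, hCeq]
        have e1 : insert y (insert z (C ∩ E₁ ∪ C ∩ E₂)) = insert y (insert z (C ∩ E₁)) ∪ C ∩ E₂ := by
          rw [Finset.insert_union, Finset.insert_union]
        have e2 : insert z (C ∩ E₁ ∪ C ∩ E₂) = insert z (C ∩ E₁) ∪ C ∩ E₂ := (Finset.insert_union _ _ _).symm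
        have e3 : insert y (C ∩ E₁ ∪ C ∩ E₂) = insert y (C ∩ E₁) ∪ C ∩ E₂ := (Finset.insert_union _ _ _).symm
        rw [e1, e2, e3]
        exact orAttW_parallel_same_nonpos g₁ g₂ gS hstne hdN (hNF _) (hCF _) hy₁ hz₁ (hNF _) (hCF _)
          (fun w' hw' h' hm' => ih hcard₁ h₁ hst₁ (hNF _) (hCF _) hy₁ hz₁ hyz (hyN₁ _) (hzN₁ _) (hyC₁ _)
            (hzC₁ _) (hNCF _) w' hw' h' hm')
          (orAtt_inKK hst₁ h₁ hy₁ hz₁ hyN hzN hNC) (orAtt_inP h₂ hNC) hw hmono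
      · -- y ∈ E₁, z ∈ E₂: the separating junction
        have hNeq : N = N ∩ E₁ ∪ N ∩ E₂ := by rw [← Finset.inter_union_distrib_left, Finset.inter_eq_left.2 hN]
        have hCeq : C = C ∩ E₁ ∪ C ∩ E₂ := by rw [← Finset.inter_union_distrib_left, Finset.inter_eq_left.2 hC]
        rw [hNeq] at hmono
        rw [hNeq, hCeq]
        have e1 : insert y (insert z (C ∩ E₁ ∪ C ∩ E₂)) = insert y (C ∩ E₁) ∪ insert z (C ∩ E₂) := by
          rw [Finset.insert_union, Finset.union_insert]
        have e2 : insert z (C ∩ E₁ ∪ C ∩ E₂) = C ∩ E₁ ∪ insert z (C ∩ E₂) := (Finset.union_insert _ _ _).symm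
        have e3 : insert y (C ∩ E₁ ∪ C ∩ E₂) = insert y (C ∩ E₁) ∪ C ∩ E₂ := (Finset.insert_union _ _ _).symm
        rw [e1, e2, e3]
        exact orAttW_parallel_split_nonpos g₁ g₂ gS hstne hdN (hNF _) (hCF _) hy₁ (hyN₁ _) (hNF _) (hCF _) hz₂ (hzN₁ _)
          (orAtt_inU h₁ hy₁ hyC hNC) (orAtt_inA h₁ hy₁ hyN hNC) (orAtt_inK hst₁ h₁ hy₁ hyN hNC) (orAtt_inU h₂ hz₂ hzC hNC) (orAtt_inA h₂ hz₂ hzN hNC) (orAtt_inK hst₂ h₂ hz₂ hzN hNC) hw hmono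
      · -- y ∈ E₂, z ∈ E₁: the separating junction with the roles of y and z exchanged
        have hNeq : N = N ∩ E₁ ∪ N ∩ E₂ := by rw [← Finset.inter_union_distrib_left, Finset.inter_eq_left.2 hN]
        have hCeq : C = C ∩ E₁ ∪ C ∩ E₂ := by rw [← Finset.inter_union_distrib_left, Finset.inter_eq_left.2 hC]
        rw [hNeq] at hmono
        rw [hNeq, hCeq]
        have e1 : insert y (insert z (C ∩ E₁ ∪ C ∩ E₂)) = insert z (C ∩ E₁) ∪ insert y (C ∩ E₂) := by
          rw [Finset.insert_comm, Finset.insert_union, Finset.union_insert]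
        have e2 : insert z (C ∩ E₁ ∪ C ∩ E₂) = insert z (C ∩ E₁) ∪ C ∩ E₂ := (Finset.insert_union _ _ _).symm
        have e3 : insert y (C ∩ E₁ ∪ C ∩ E₂) = C ∩ E₁ ∪ insert y (C ∩ E₂) := (Finset.union_insert _ _ _).symm
        rw [e1, e2, e3]
        have key := orAttW_parallel_split_nonpos g₁ g₂ gS hstne hdN (hNF _) (hCF _) hz₁ (hzN₁ _) (hNF _) (hCF _) hy₂ (hyN₁ _)
          (orAtt_inU h₁ hz₁ hzC hNC) (orAtt_inA h₁ hz₁ hzN hNC) (orAtt_inK hst₁ h₁ hz₁ hzN hNC) (orAtt_inU h₂ hy₂ hyC hNC) (orAtt_inA h₂ hy₂ hyN hNC) (orAtt_inK hst₂ h₂ hy₂ hyN hNC) hw hmono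
        linarith
      · -- y, z ∈ E₂: the one-sided junction with the sides exchanged
        have hNeq : N = N ∩ E₂ ∪ N ∩ E₁ := by
          rw [← Finset.inter_union_distrib_left, Finset.union_comm, Finset.inter_eq_left.2 hN]
        have hCeq : C = C ∩ E₂ ∪ C ∩ E₁ := by
          rw [← Finset.inter_union_distrib_left, Finset.union_comm, Finset.inter_eq_left.2 hC]
        rw [hNeq] at hmono
        rw [hNeq, hCeq]
        have e1 : insert y (insert z (C ∩ E₂ ∪ C ∩ E₁)) = insert y (insert z (C ∩ E₂)) ∪ C ∩ E₁ := by
          rw [Finset.insert_union, Finset.insert_union]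
        have e2 : insert z (C ∩ E₂ ∪ C ∩ E₁) = insert z (C ∩ E₂) ∪ C ∩ E₁ := (Finset.insert_union _ _ _).symm
        have e3 : insert y (C ∩ E₂ ∪ C ∩ E₁) = insert y (C ∩ E₂) ∪ C ∩ E₁ := (Finset.insert_union _ _ _).symm
        rw [e1, e2, e3]
        exact orAttW_parallel_same_nonpos g₂ g₁ gS' hstne hdN.symm (hNF _) (hCF _) hy₂ hz₂ (hNF _) (hCF _)
          (fun w' hw' h' hm' => ih hcard₂ h₂ hst₂ (hNF _) (hCF _) hy₂ hz₂ hyz (hyN₁ _) (hzN₁ _) (hyC₁ _)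
            (hzC₁ _) (hNCF _) w' hw' h' hm')
          (orAtt_inKK hst₂ h₂ hy₂ hz₂ hyN hzN hNC) (orAtt_inP h₁ hNC) hw hmono

end OrAttPath

end FK

end Summit.CriticalPhenomena.PercolationContinuityZ3.Theorems

end
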